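import Literature.NumberTheory.EllipticCurves.HeightConductorBoundsPropTenEightProofs
import Literature.NumberTheory.EllipticCurves.PastenHeightBoundsClassicalInputProofs
import Literature.NumberTheory.EllipticCurves.ComplexPeriodProofs
import Mathlib.Analysis.Complex.ExponentialBounds
import HarnessLib

/-!
# von Känel 2014, Prop. 6.1 and Cor. 6.2 from von Känel–Matschke's Prop. 10.8 / (eq:szpiro), and the
# `abc` shape `log c ≪ rad · (log rad)²` from Cor. 6.2 (proofs)

Topic `Literature/NumberTheory/EllipticCurves` (family `abc`, LADDER-ABC A1: the *modular method*).
A proofs-only companion (theorems only; NO definition, NO new named fact, nothing restated; D-0014,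
D-0026) of `HeightConductorBoundsModularity.lean`, where von Känel's 2014 height–conductor bound
(Prop. 6.1: `h(E) ≤ ¼ N_E (log N_E)² + 9`) and discriminant–conductor bound (Cor. 6.2:
`log Δ_E ≤ 3 N_E (log N_E)² + 124`) are typed as named facts next to vKM Prop. 10.8 and (eq:szpiro).

Sources (held texts, read at the locators): R. von Känel, *Integral points on moduli schemes of elliptic
curves*, TLMS 1 (2014) = arXiv:1310.7263 [`VonKanelModuli2014`], §6.1 (Prop. 6.1; Cor. 6.2 with its
two-line proof "This follows from Proposition (prop:he), since `log Δ_E ≤ 12h(E) + 16` by Lemma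
(lem:dehe)"); R. von Känel, B. Matschke, arXiv:1605.06079 = Mem. AMS 286 (2023) [`VonkanelMatschke2023`],
§10.5.2 ("Proposition (prop:explbounds) … updates `2h(E) ≤ ½ N(log N)² + 18` of [rvk:modular]") and
§10.5.3 ("These inequalities [(eq:szpiro)] update the discriminant conductor inequalities in Murty–Pasten
and in [rvk:modular]").

## What is proved here

* `vonKanel2014_height_le_of_prop_10_8_i` — **vK Prop. 6.1 ⇐ {modularity, vKM Prop. 10.8 (i)}**: for a
  globally minimal `W` and ANY period pair `L` spanning its Néron lattice, `h(E) = h(D.L)` for the datum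
  `D` of `W` (`neronLatticeHeight_eq_of_isNeronLatticeOf`), `N_E ≥ 11` (`eleven_le_conductorNorm_of_modularity`),
  `2h ≤ κ + (1/6)ν log N + (1/16)ν log₃ N + (1/9)ν` (`two_mul_height_le_of_prop_10_8_i`, (ii) a THEOREM),
  `κ ≤ 16.52`, `0 ≤ ν ≤ N`, `log₃ N ≤ log N`, `log N ≥ log 11 > 2`: hence `2h ≤ ½ N (log N)² + 18`.
* `vonKanel2014_log_minimalDiscriminant_le_of_height_le` — **vK Cor. 6.2 ⇐ vK Prop. 6.1**, the printed
  proof, for EVERY elliptic `W/ℚ` (global minimal model `hasGlobalMinimalModel_rat_holds`, a Néron period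
  pair by the uniformisation theorem `exists_periodPair_of_isElliptic'`, Silverman's `log|Δ| ≤ 12h + 16`
  through the tree's `vonKanel2014_log_abs_Δ_le_of`, and `N(𝔇_min) = |Δ_min|`). Unconditional link.
* `szpiro_shape_le_vonKanel2014`, `vonKanel2014_log_minimalDiscriminant_le_of_szpiro` — **vK Cor. 6.2 ⇐
  vKM (eq:szpiro)** for every `E/ℚ` (`ν log N + (3/8)ν log₃N + (2/3)ν + 115.1 ≤ 3N(log N)² + 124` for all
  `N ≥ 1`, `0 ≤ ν ≤ N`); hence `…_of_prop_10_8_i`: vK Cor. 6.2 ⇐ {modularity, Prop. 10.8 (i)}.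
* `abcTriple_log_le_of_vonKanel2014`, `bakerShapeBound_one_two_of_vonKanel2014`,
  `epsShapeBound_one_of_bakerShapeBound_one_two`, `epsShapeBound_one_of_vonKanel2014(_height_le)` —
  the Frey–Hellegouarch translation of Cor. 6.2 (vK §7.2.2 "an effective version of Frey's remark"; the
  tree's PROVED global minimal Frey model `exists_frey_model_sq_dvd`: `(abc)² ∣ 2⁸Δ_min`, `N ∣ 2¹⁰ rad`):
  `log c ≤ 2·10⁵ · R (log R)²` for every `abc` triple, i.e. `Literature.Barriers.ABC.BakerShapeBound 1 2`,
  hence `EpsShapeBound 1` (rung A1.P of LADDER-ABC, a third printed root: vK 2014 Cor. 6.2 / Prop. 6.1 ALONE).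

After this file the vK 2014 named facts Prop. 6.1 and Cor. 6.2 are DERIVED from the vKM §10 roots
{`nonempty_modularParametrizationData`, `vonKanelMatschke_prop_10_8_i`}. NOT derived (printed via the
moduli schemes `M(𝒫)` / Shimura–Taniyama counting): vK Cor. 6.3, Prop. 6.4. No `abc` claim; axioms standard.
-/

noncomputable section

open WeierstrassCurve IsDedekindDomain

namespace Literature.NumberTheory.EllipticCurves.ModularForms

open DiophantineGeometry

/-! ### Real-analysis helper: the junk-valued triple logarithm -/

/-- `log log log x ≤ log x` for real `x ≥ 2` (all three `Real.log`s, junk values included). [folklore] -/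
private theorem logloglog_le_log_vk {x : ℝ} (hx : 2 ≤ x) :
    Real.log (Real.log (Real.log x)) ≤ Real.log x := by
  have hl2 := Real.log_two_gt_d9
  have hL1 : Real.log 2 ≤ Real.log x := Real.log_le_log (by norm_num) hx
  have hL1pos : 0 < Real.log x := by linarith
  have hL2 : Real.log (Real.log x) ≤ Real.log x - 1 := Real.log_le_sub_one_of_pos hL1pos
  rcases lt_trichotomy (Real.log (Real.log x)) 0 with hneg | hzero | hpos
  · have h1 : Real.log (Real.log (Real.log x)) = Real.log (-Real.log (Real.log x)) := by
      rw [Real.log_neg_eq_log]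
    have h2 : Real.log (-Real.log (Real.log x)) ≤ -Real.log (Real.log x) - 1 :=
      Real.log_le_sub_one_of_pos (by linarith)
    have h3 : -Real.log (Real.log x) = Real.log ((Real.log x)⁻¹) := by rw [Real.log_inv]
    have h4 : Real.log ((Real.log x)⁻¹) ≤ (Real.log x)⁻¹ - 1 :=
      Real.log_le_sub_one_of_pos (inv_pos.mpr hL1pos)
    have h5 : (Real.log x)⁻¹ ≤ (Real.log 2)⁻¹ := inv_anti₀ (by linarith) hL1
    have h6 : (Real.log 2)⁻¹ < 2 := by
      rw [inv_eq_one_div, div_lt_iff₀ (by linarith)]; linarith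
    linarith
  · rw [hzero, Real.log_zero]; linarith
  · have h3 : Real.log (Real.log (Real.log x)) ≤ Real.log (Real.log x) - 1 :=
      Real.log_le_sub_one_of_pos hpos
    linarith

/-- `log log log N ≤ log N` for every natural `N ≥ 1` (`N = 1`: both sides `0`). [folklore] -/
private theorem logloglog_natCast_le_vk {N : ℕ} (hN : 1 ≤ N) :
    Real.log (Real.log (Real.log (N : ℝ))) ≤ Real.log (N : ℝ) := by
  rcases eq_or_lt_of_le hN with h1 | h2
  · rw [← h1]; simp
  · exact logloglog_le_log_vk (by exact_mod_cast (h2 : 2 ≤ N))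

/-! ### von Känel 2014, Prop. 6.1 from modularity and vKM Prop. 10.8 (i) -/

/-- **The vKM Faltings-height bound is dominated by von Känel's 2014 bound**: for `N ≥ 11` and
`0 ≤ ν ≤ N`, `κ + (1/6)ν log N + (1/16)ν log₃N + (1/9)ν ≤ ½ N (log N)² + 18` (`κ ≤ 16.516572`,
`log₃ N ≤ log N`, `log N ≥ log 8 = 3 log 2 > 2`; vKM §10.5.2: Prop. 10.8 "updates `2h(E) ≤ ½N(log N)² + 18`
of [rvk:modular]"). [cite: VonkanelMatschke2023, §10.5.2 (comparison after Prop. 10.8)] -/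
theorem height_shape_le_vonKanel2014 {N : ℕ} (hN : 11 ≤ N) {ν : ℝ} (hν0 : 0 ≤ ν) (hνN : ν ≤ N) :
    vkmKappa + (1 / 6 * ν * Real.log N + 1 / 16 * ν * Real.log (Real.log (Real.log N)) + 1 / 9 * ν) ≤
      2 * (1 / 4 * (N : ℝ) * Real.log N ^ 2 + 9) := by
  have hκ := vkmKappa_le
  have hl2 := Real.log_two_gt_d9
  have hN0 : (0 : ℝ) ≤ N := Nat.cast_nonneg N
  have hlogN : 2 ≤ Real.log (N : ℝ) := by
    have h8 : Real.log 8 = 3 * Real.log 2 := by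
      rw [show (8 : ℝ) = 2 ^ 3 by norm_num, Real.log_pow]; push_cast; ring
    have : Real.log 8 ≤ Real.log (N : ℝ) :=
      Real.log_le_log (by norm_num) (by exact_mod_cast (by omega : 8 ≤ N))
    linarith
  have hl3 := logloglog_natCast_le_vk (N := N) (by omega)
  set t := Real.log (N : ℝ) with ht
  have h1 : ν * Real.log (Real.log t) ≤ ν * t := mul_le_mul_of_nonneg_left hl3 hν0
  have h2 : ν * t ≤ N * t := mul_le_mul_of_nonneg_right hνN (by linarith)
  have h3 : N * t ≤ N * t ^ 2 / 2 := by nlinarith [mul_nonneg hN0 (by linarith : (0 : ℝ) ≤ t)]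
  nlinarith

/-- **vK 2014 Prop. 6.1 (`h(E) ≤ ¼ N_E (log N_E)² + 9`) from modularity and vKM Prop. 10.8 (i)** (PROVED
deduction; Prop. 10.8 (ii) is the tree's theorem `vonKanelMatschke_prop_10_8_ii_holds`): for a globally
minimal `W` with conductor `N ≥ 11` (`eleven_le_conductorNorm_of_modularity`) take its datum `D`
(`nonempty_modularParametrizationData`); `h(L) = h(D.L)` for every Néron period pair `L` of `W`
(`neronLatticeHeight_eq_of_isNeronLatticeOf`), and `two_mul_height_le_of_prop_10_8_i` +
`height_shape_le_vonKanel2014`. The named fact `vonKanel2014_height_le` is no longer an independent root.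
[cite: VonKanelModuli2014, Prop. 6.1] [cite: VonkanelMatschke2023, Prop. 10.8 and §10.5.2] -/
theorem vonKanel2014_height_le_of_prop_10_8_i (hmod : nonempty_modularParametrizationData)
    (hi : vonKanelMatschke_prop_10_8_i) : vonKanel2014_height_le := by
  intro W _ _ L hL
  haveI : NeZero (W.conductorNorm ℤ) := ⟨(conductorNorm_pos_holds W).ne'⟩
  obtain ⟨D⟩ := hmod W
  have h11 : 11 ≤ W.conductorNorm ℤ := eleven_le_conductorNorm_of_modularity hmod W
  have h2h := two_mul_height_le_of_prop_10_8_i hi W (W.conductorNorm ℤ) rfl h11 D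
  have hshape := height_shape_le_vonKanel2014 h11 (condNu_nonneg (W.conductorNorm ℤ))
    (condNu_le_self (W.conductorNorm ℤ))
  rw [neronLatticeHeight_eq_of_isNeronLatticeOf hL D.isNeronLattice]
  linarith

/-! ### von Känel 2014, Cor. 6.2 from Prop. 6.1 (the printed proof), for every `E/ℚ` -/

/-- **vK 2014 Cor. 6.2 ⇐ vK 2014 Prop. 6.1** (the printed proof: "This follows from Proposition (prop:he),
since `log Δ_E ≤ 12h(E) + 16` by Lemma (lem:dehe)"), for EVERY elliptic `W/ℚ`: pass to a global minimal
model `C • W` (`N_E`, `Δ_E` invariant), choose a Néron period pair by the uniformisation theorem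
(`exists_periodPair_of_isElliptic'`), apply the tree's minimal-model form `vonKanel2014_log_abs_Δ_le_of`
(Prop. 6.1 + Silverman), and `N(𝔇_min) = |Δ(C • W)|` (`cast_minimalDiscriminantNorm_eq_abs`). Unconditional.
[cite: VonKanelModuli2014, Cor. 6.2 (with its proof)] -/
theorem vonKanel2014_log_minimalDiscriminant_le_of_height_le (h61 : vonKanel2014_height_le) :
    vonKanel2014_log_minimalDiscriminant_le := by
  intro W _
  obtain ⟨C, hC⟩ := hasGlobalMinimalModel_rat_holds W
  haveI := hC
  have hNeq : (C • W).conductorNorm ℤ = W.conductorNorm ℤ := conductorNorm_smul_rat W C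
  have hΔeq : (C • W).minimalDiscriminantNorm ℤ = W.minimalDiscriminantNorm ℤ :=
    minimalDiscriminantNorm_smul_rat W C
  obtain ⟨L, hL2, hL3⟩ := ((C • W).baseChange ℂ).exists_periodPair_of_isElliptic'
  have hL : IsNeronLatticeOf ((C • W).baseChange ℂ) L := ⟨hL2, hL3⟩
  have h1 := vonKanel2014_log_abs_Δ_le_of h61 (C • W) L hL
  have hcast := Pasten2024.cast_minimalDiscriminantNorm_eq_abs (C • W)
  rw [← hNeq, ← hΔeq, hcast]
  exact h1

/-! ### von Känel 2014, Cor. 6.2 from vKM (eq:szpiro) -/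

/-- **(eq:szpiro) is dominated by von Känel's 2014 discriminant bound**: for `N ≥ 1` and `0 ≤ ν ≤ N`,
`ν log N + (3/8)ν log₃N + (2/3)ν + 115.1 ≤ 3N(log N)² + 124` (`log₃N ≤ log N`; for `N ≥ 3`, `log N ≥ 1`
and `(11/8)Nt + (2/3)N ≤ 3Nt²`; for `N ≤ 2`, `(11/8)Nt + (2/3)N ≤ 4.1 ≤ 8.9`). vKM §10.5.3: "These
inequalities update the discriminant conductor inequalities in Murty–Pasten and in [rvk:modular]".
[cite: VonkanelMatschke2023, §10.5.3 (comparison after (eq:szpiro))] -/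
theorem szpiro_shape_le_vonKanel2014 {N : ℕ} (hN : 1 ≤ N) {ν : ℝ} (hν0 : 0 ≤ ν) (hνN : ν ≤ N) :
    ν * Real.log N + 3 / 8 * ν * Real.log (Real.log (Real.log N)) + 2 / 3 * ν + 115.1 ≤
      3 * (N : ℝ) * Real.log N ^ 2 + 124 := by
  have hl2 := Real.log_two_lt_d9
  have hN0 : (0 : ℝ) ≤ N := Nat.cast_nonneg N
  have hN1 : (1 : ℝ) ≤ N := by exact_mod_cast hN
  have hlogN0 : 0 ≤ Real.log (N : ℝ) := Real.log_nonneg hN1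
  have hl3 := logloglog_natCast_le_vk hN
  set t := Real.log (N : ℝ) with ht
  have h1 : ν * Real.log (Real.log t) ≤ ν * t := mul_le_mul_of_nonneg_left hl3 hν0
  have h2 : ν * t ≤ N * t := mul_le_mul_of_nonneg_right hνN hlogN0
  have hNt2 : 0 ≤ (N : ℝ) * t ^ 2 := by positivity
  by_cases h3 : 3 ≤ N
  · -- `t ≥ log 3 > 1`
    have ht1 : 1 ≤ t := by
      have he := Real.exp_one_lt_d9
      have h3' : Real.log (Real.exp 1) ≤ Real.log (N : ℝ) :=
        Real.log_le_log (Real.exp_pos 1) (by linarith [show (3 : ℝ) ≤ N by exact_mod_cast h3])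
      rwa [Real.log_exp] at h3'
    have h4 : (N : ℝ) * t ≤ N * t ^ 2 := by nlinarith [mul_nonneg hN0 hlogN0]
    have h5 : (N : ℝ) ≤ N * t := by nlinarith
    nlinarith
  · -- `N ∈ {1, 2}`: `t ≤ log 2 < 0.7`
    have hN2 : (N : ℝ) ≤ 2 := by exact_mod_cast (by omega : N ≤ 2)
    have ht2 : t ≤ Real.log 2 := Real.log_le_log (by linarith) hN2
    have h4 : (N : ℝ) * t ≤ 2 * 0.7 := mul_le_mul hN2 (by linarith) hlogN0 (by norm_num)
    nlinarith

/-- **vK 2014 Cor. 6.2 ⇐ vKM (eq:szpiro)** (fact-to-fact, for every elliptic `W/ℚ`; `N_E ≥ 1` by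
`conductorNorm_pos_holds`, `0 ≤ ν ≤ N`). [cite: VonKanelModuli2014, Cor. 6.2]
[cite: VonkanelMatschke2023, §10.5.3 display (eq:szpiro) and the comparison following it] -/
theorem vonKanel2014_log_minimalDiscriminant_le_of_szpiro (hsz : vonKanelMatschke_log_minimalDiscriminant_le) :
    vonKanel2014_log_minimalDiscriminant_le := by
  intro W _
  have h1 := hsz W
  have hN : 1 ≤ W.conductorNorm ℤ := conductorNorm_pos_holds W
  exact h1.trans (szpiro_shape_le_vonKanel2014 hN (condNu_nonneg _) (condNu_le_self _))

/-- **vK 2014 Cor. 6.2 from modularity and vKM Prop. 10.8 (i)** (two printed roads: via Prop. 6.1,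
`vonKanel2014_log_minimalDiscriminant_le_of_height_le ∘ vonKanel2014_height_le_of_prop_10_8_i`, or via
(eq:szpiro), `…_of_szpiro ∘ log_minimalDiscriminant_le_of_prop_10_8_i`; the latter is used).
[cite: VonKanelModuli2014, Cor. 6.2] [cite: VonkanelMatschke2023, §10.5.3] -/
theorem vonKanel2014_log_minimalDiscriminant_le_of_prop_10_8_i (hmod : nonempty_modularParametrizationData)
    (hi : vonKanelMatschke_prop_10_8_i) : vonKanel2014_log_minimalDiscriminant_le :=
  vonKanel2014_log_minimalDiscriminant_le_of_szpiro (log_minimalDiscriminant_le_of_prop_10_8_i hmod hi)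

/-! ### The `abc` shape `log c ≪ rad (log rad)²` from vK 2014 Cor. 6.2 (Frey–Hellegouarch translation) -/

/-- **vK Cor. 6.2 ⟹ `log c ≤ 2·10⁵ · R (log R)²` for EVERY `abc` triple** (`R = rad(abc)`; the
Frey–Hellegouarch translation behind vK §7.2.2 "an effective version of Frey's remark", with crude
constants): for the tree's global minimal Frey model `W₀` (`exists_frey_model_sq_dvd`),
`2 log c ≤ 8 log 2 + log Δ_min`, `N ≤ 2¹⁰ R`, `log N ≤ 10 log 2 + log R ≤ 11 log R` (`R ≥ 2`), so Cor. 6.2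
gives `2 log c ≤ 8 log 2 + 3·2¹⁰R·(11 log R)² + 124 ≤ 4·10⁵ R (log R)²`.
[cite: VonKanelModuli2014, Cor. 6.2 and §7.2.2 (proof of Cor. 7.2)] -/
theorem abcTriple_log_le_of_vonKanel2014 (h62 : vonKanel2014_log_minimalDiscriminant_le) {a b c : ℕ}
    (ht : IsABCTriple a b c) :
    Real.log c ≤ 200000 * ((rad a b c : ℝ) * Real.log (rad a b c : ℕ) ^ 2) := by
  obtain ⟨W₀, hE, hN, hΔ⟩ := exists_frey_model_sq_dvd ht
  haveI := hE
  have h62' := h62 (W₀.baseChange ℚ)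
  have ht' := ht
  obtain ⟨ha, hb, habc, hcop⟩ := ht'
  have hc : 0 < c := by omega
  have hΔpos : 0 < (W₀.baseChange ℚ).minimalDiscriminantNorm ℤ := minimalDiscriminantNorm_pos_holds _
  have hNpos : 0 < (W₀.baseChange ℚ).conductorNorm ℤ := conductorNorm_pos_holds _
  have hradpos : 0 < rad a b c := by rw [rad_def]; exact Nat.radical_pos _
  have hR2 : (2 : ℝ) ≤ (rad a b c : ℝ) := by exact_mod_cast IsABCTriple.two_le_rad ht
  have hN1 : (1 : ℝ) ≤ ((W₀.baseChange ℚ).conductorNorm ℤ : ℝ) := by exact_mod_cast hNpos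
  have hD0 : (0 : ℝ) < ((W₀.baseChange ℚ).minimalDiscriminantNorm ℤ : ℝ) := by exact_mod_cast hΔpos
  have hNR : ((W₀.baseChange ℚ).conductorNorm ℤ : ℝ) ≤ 1024 * (rad a b c : ℝ) := by
    have := Nat.le_of_dvd (mul_pos (by positivity) hradpos) hN
    exact_mod_cast this
  have hc2 : (c : ℝ) ^ 2 ≤ 2 ^ 8 * ((W₀.baseChange ℚ).minimalDiscriminantNorm ℤ : ℝ) := by
    have h1 : c ≤ a * b * c := Nat.le_mul_of_pos_left c (by positivity)
    have h2 : (a * b * c) ^ 2 ≤ 2 ^ 8 * (W₀.baseChange ℚ).minimalDiscriminantNorm ℤ :=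
      Nat.le_of_dvd (by positivity) hΔ
    have h3 : c ^ 2 ≤ 2 ^ 8 * (W₀.baseChange ℚ).minimalDiscriminantNorm ℤ :=
      (Nat.pow_le_pow_left h1 2).trans h2
    exact_mod_cast h3
  set N : ℝ := ((W₀.baseChange ℚ).conductorNorm ℤ : ℝ) with hNdef
  set D : ℝ := ((W₀.baseChange ℚ).minimalDiscriminantNorm ℤ : ℝ) with hDdef
  set R : ℝ := (rad a b c : ℝ) with hRdef
  have hl2 := Real.log_two_lt_d9
  have hl2' := Real.log_two_gt_d9
  have hlogN0 : 0 ≤ Real.log N := Real.log_nonneg hN1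
  have hlogc : 2 * Real.log c ≤ 8 * Real.log 2 + Real.log D := by
    have h1 : Real.log ((c : ℝ) ^ 2) ≤ Real.log (2 ^ 8 * D) :=
      Real.log_le_log (by positivity) hc2
    rw [Real.log_pow, Real.log_mul (by positivity) hD0.ne', Real.log_pow] at h1
    push_cast at h1
    linarith
  have hL : Real.log 2 ≤ Real.log R := Real.log_le_log (by norm_num) hR2
  have hlogN : Real.log N ≤ 11 * Real.log R := by
    have h1 : Real.log N ≤ Real.log (1024 * R) := Real.log_le_log (by linarith) hNR
    rw [Real.log_mul (by norm_num) (by linarith), show (1024 : ℝ) = 2 ^ 10 by norm_num,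
      Real.log_pow] at h1
    push_cast at h1
    linarith
  have hlogD : Real.log D ≤ 3 * N * Real.log N ^ 2 + 124 := h62'
  have hlogN2 : Real.log N ^ 2 ≤ (11 * Real.log R) ^ 2 := pow_le_pow_left₀ hlogN0 hlogN 2
  have hNlogN2 : N * Real.log N ^ 2 ≤ 1024 * R * (11 * Real.log R) ^ 2 :=
    mul_le_mul hNR hlogN2 (by positivity) (by positivity)
  have hX : 2 * Real.log 2 ^ 2 ≤ R * Real.log R ^ 2 :=
    mul_le_mul hR2 (pow_le_pow_left₀ (by linarith) hL 2) (by positivity) (by linarith)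
  have hl22 : (0.48 : ℝ) ≤ Real.log 2 ^ 2 := by nlinarith
  nlinarith

/-- **vK Cor. 6.2 ⟹ the Baker shape `(θ, m) = (1, 2)` with `κ = 2·10⁵`** (PROVED): `log c ≤ 2·10⁵ R (log R)²`
for every `abc` triple — `Literature.Barriers.ABC.BakerShapeBound 1 2`, reached by the modular method of
2014 (before the `N log N`-type bounds of Murty–Pasten / vKM, which give the shape `(1, 1)`).
[cite: VonKanelModuli2014, Cor. 6.2 and §7.2.2] -/
theorem bakerShapeBound_one_two_of_vonKanel2014 (h62 : vonKanel2014_log_minimalDiscriminant_le) :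
    Literature.Barriers.ABC.BakerShapeBound 1 2 := by
  refine ⟨200000, fun a b c ht => ?_⟩
  have h1 := abcTriple_log_le_of_vonKanel2014 h62 ht
  rw [Real.rpow_one]
  calc Real.log c ≤ 200000 * ((rad a b c : ℝ) * Real.log (rad a b c : ℕ) ^ 2) := h1
    _ = 200000 * (rad a b c : ℝ) * Real.log (rad a b c : ℕ) ^ 2 := by ring

/-- `BakerShapeBound 1 2 ⟹ EpsShapeBound 1` (`(log R)² ≤ (2/ε)² R^ε` by `log R ≤ R^{ε/2}/(ε/2)`; the
constant `κ` of the Baker shape is `≥ 0`, tested at any triple). A shape-calculus lemma of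
`Literature.Barriers.ABC.BakerMethodBounds`. [cite: Waldschmidt2014, §2 (the ε-shape of Stewart–Yu-type bounds)] -/
theorem epsShapeBound_one_of_bakerShapeBound_one_two (h : Literature.Barriers.ABC.BakerShapeBound 1 2) :
    Literature.Barriers.ABC.EpsShapeBound 1 := by
  obtain ⟨κ, hκ⟩ := h
  intro ε hε
  refine ⟨4 * κ / ε ^ 2, 0, fun a b c ht _ => ?_⟩
  have h1 := hκ a b c ht
  rw [Real.rpow_one] at h1
  have hR1 : (1 : ℝ) ≤ (rad a b c : ℝ) := Literature.Barriers.ABC.one_le_rad_real a b c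
  have hR0 : (0 : ℝ) < (rad a b c : ℝ) := by linarith
  have hlog0 : 0 ≤ Real.log (rad a b c : ℕ) := Real.log_nonneg (by exact_mod_cast hR1)
  have hlog : Real.log (rad a b c : ℕ) ≤ (rad a b c : ℝ) ^ (ε / 2) / (ε / 2) :=
    Real.log_le_rpow_div hR0.le (by linarith)
  have hlog2 : Real.log (rad a b c : ℕ) ^ 2 ≤ ((rad a b c : ℝ) ^ (ε / 2) / (ε / 2)) ^ 2 :=
    pow_le_pow_left₀ hlog0 hlog 2
  have hsq : ((rad a b c : ℝ) ^ (ε / 2) / (ε / 2)) ^ 2 = 4 / ε ^ 2 * (rad a b c : ℝ) ^ ε := by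
    have : ((rad a b c : ℝ) ^ (ε / 2)) ^ 2 = (rad a b c : ℝ) ^ ε := by
      rw [← Real.rpow_natCast, ← Real.rpow_mul hR0.le]; norm_num
    rw [div_pow, this]; ring
  have hκ0 : 0 ≤ κ := by
    have hc : (2 : ℝ) ≤ c := by exact_mod_cast ht.two_le
    have hlc : 0 < Real.log c := Real.log_pos (by linarith)
    have hRl : 0 < (rad a b c : ℝ) * Real.log (rad a b c : ℕ) ^ 2 :=
      mul_pos hR0 (pow_pos (Real.log_pos (by exact_mod_cast ht.two_le_rad)) 2)
    nlinarith
  have hRε : 0 ≤ (rad a b c : ℝ) ^ ε := Real.rpow_nonneg hR0.le _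
  calc Real.log c ≤ κ * (rad a b c : ℝ) * Real.log (rad a b c : ℕ) ^ 2 := h1
    _ ≤ κ * (rad a b c : ℝ) * (4 / ε ^ 2 * (rad a b c : ℝ) ^ ε) := by
        rw [← hsq]; exact mul_le_mul_of_nonneg_left hlog2 (mul_nonneg hκ0 hR0.le)
    _ = 4 * κ / ε ^ 2 * ((rad a b c : ℝ) ^ (1 : ℝ) * (rad a b c : ℝ) ^ ε) := by rw [Real.rpow_one]; ring
    _ = 4 * κ / ε ^ 2 * (rad a b c : ℝ) ^ (1 + ε : ℝ) := by rw [← Real.rpow_add hR0]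

/-- **vK Cor. 6.2 ⟹ `EpsShapeBound 1`** (`log c ≪_ε rad^{1+ε}`; rung A1.P of LADDER-ABC, reached from the
single printed theorem vK 2014 Cor. 6.2). [cite: VonKanelModuli2014, Cor. 6.2 and §7.2.2] -/
theorem epsShapeBound_one_of_vonKanel2014 (h62 : vonKanel2014_log_minimalDiscriminant_le) :
    Literature.Barriers.ABC.EpsShapeBound 1 :=
  epsShapeBound_one_of_bakerShapeBound_one_two (bakerShapeBound_one_two_of_vonKanel2014 h62)

/-- **vK Prop. 6.1 ⟹ `EpsShapeBound 1`** (through Cor. 6.2, `vonKanel2014_log_minimalDiscriminant_le_of_height_le`):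
the modular method of 2014 reaches the exponential class `EpsShapeBound 1` from the height–conductor
bound alone. [cite: VonKanelModuli2014, Prop. 6.1, Cor. 6.2 and §7.2.2] -/
theorem epsShapeBound_one_of_vonKanel2014_height_le (h61 : vonKanel2014_height_le) :
    Literature.Barriers.ABC.EpsShapeBound 1 :=
  epsShapeBound_one_of_vonKanel2014 (vonKanel2014_log_minimalDiscriminant_le_of_height_le h61)

end Literature.NumberTheory.EllipticCurves.ModularForms

end
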